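import Summits.ABC.ABC.Theses.IsogenyGlueCongruence
import Summits.ABC.ABC.Theorems.IsogenyGlueCongruenceDegreePrimesPolyBoundedStubGlue
import Summits.ABC.ABC.Theorems.IsogenyGlueCongruenceDegreePrimesPolyBoundedStubOldPartner
import Summits.ABC.ABC.Theorems.IsogenyGlueCongruenceDegreePrimesPolyBoundedStubSpectral
import Summits.ABC.ABC.Theorems.IsogenyGlueCongruenceDegreePrimesPolyBoundedStubMinimalPrimes
import Summits.ABC.ABC.Theorems.IsogenyGlueCongruenceDegreePrimesPolyBoundedStubDiscValuation
import Summits.ABC.ABC.Theorems.IsogenyGlueCongruenceSemistableHeightPolyBoundModular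
import Literature.NumberTheory.EllipticCurves.PeriodRelationsProofs
import HarnessLib

/-!
# Crux A `DegreePrimesPolyBounded` (stmt-ABC-2045), line `newpart-congruence-friability` — the frame

The kernel-checked REDUCTION of crux A (every prime factor `ℓ` of the modular degree of a semistable
`E/ℚ`, globally minimal model `W`, conductor `N`, `∃ D` form, is `≤ C · N^κ`) to THREE pieces of known
mathematics and ONE E-free statement about the anemic Hecke order `𝕋_N = ℤ[T_p : p ∤ N]` of a
squarefree level (the line's bet):

* (known, XL debt) `ModularDatumExists` = `nonempty_modularParametrizationData` (BCDT 2001 Thm A +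
  Edixhoven 1991; the line uses only semistable `W`);
* (known, XL debt) `PastenShimura2024_minimalDegree_le_163_mul` (Mazur 1978 + Kenku 1982 via
  Pasten 2024 §3);
* (known, L) the Galois input of the old-partner peeling: an old-level congruence prime `ℓ ≥ 11`,
  `ℓ ∤ N`, of `f_W` divides a Tamagawa exponent `v_p(Δ_min(W))`, `p ∣ N`, `p ∤ M` (Carayol,
  Chebotarev–Brauer–Nesbitt, Mazur irreducibility, Tate curve; Ribet 1990 §§1–2);
* THE BET, E-free — graded new-part friability: for `N` squarefree and newforms `f, g` of level `N`
  with `𝕀_f ≠ 𝕀_g`, every prime `ℓ ∣ η(f,[g]) = #𝕋_N/(𝕀_f + 𝕀_g) ≠ 0` is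
  `≤ C · N^{κ · rank_ℤ(𝕋_N/𝕀_f)}`; only its rank-one slice (rational `f`) is consumed.

Main results (all hypotheses stated inline; no new definitions):

* `degreePrimesPolyBounded_of_gradedNewPartFriability` — the four statements imply crux A;
* `degreePrimesPolyBounded_of_rationalNewPartFriability` — the same with the rank-one slice;
* `degreePrimesPolyBounded_of_newPartPrimesOfDatum` — the glue proper (datum form of the bet plus
  the PROVED inputs: Pasten Thm 5.5 `stub_spectral`, the Atkin–Lehner–Li classification
  `stub_minimalPrimes`, the peeling `stub_oldPartner_of`, and `v_p(Δ_min) ≤ C N²`);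
* `discValuation_of_modularity_of_mazurKenku` — `v_p(Δ_min(W)) ≤ C · N_W²` for semistable minimal
  `W` from modularity + Mazur–Kenku + the THEOREM `PastenShimura2024_thm_5_5_holds` (classical
  modular approach `h(E) ≤ ½ N log N + 9`, Shafarevich below the threshold, Pasten Lemma 18.1);
  no `pasten_thm_7_5` is needed;
* `degreePrimesPolyBounded_of_smallHeckeSeparators` — the sibling engine (line `Sketch`,
  `newPartPrimes_of_smallHeckeSeparators`) on the same frame, without `pasten_thm_7_5`;
* calibration `newPartPrime_le_rpow_finrank_partner` — what is already a theorem: a new congruence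
  prime of a curve datum at level `N ≥ 11` is `≤ N^{3 · rank_ℤ(𝕋/𝕀_g)}` (PARTNER's rank in the
  exponent; the bet asks for the base orbit's rank).

Source of the argument: planner crux-plan skeleton `Cruxes/DegreePrimesPolyBounded/Lines/
newpart_congruence_friability.lean` (2026-08-16), itself the lead -0 glue of line `Sketch` (p89252)
with the D-form new-part bound as hypothesis.
-/

set_option linter.dupNamespace false

noncomputable section

open scoped MatrixGroups ModularForm
open CongruenceSubgroup
open Literature.NumberTheory.EllipticCurves.ModularForms
open Summit.ABC.ABC.Theses.IsogenyGlueCongruence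

namespace Summit.ABC.ABC.Theorems.DegreePrimesPolyBounded

/-! ## Reductions between the E-free statements -/

/-- **Symmetry of the congruence modulus of two orbits**: `η(f,[g]) = η(g,[f])` (`= #𝕋/(𝕀_f + 𝕀_g)`). -/
theorem heckeCongruenceModulus_comm {N : ℕ} [NeZero N] (f g : CuspForm (Gamma0 N) 2) :
    heckeCongruenceModulus f (eigenIdeal g) = heckeCongruenceModulus g (eigenIdeal f) :=
  congruenceModulus_comm _ _

/-- The graded bet in its `min` form: by symmetry a gluing prime is bounded through the SMALLER of
the two orbit ranks. -/
theorem gradedNewPartFriability_min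
    (hG : ∃ κ C : ℝ, ∀ (N : ℕ) [NeZero N], Squarefree N →
      ∀ (f g : CuspForm (Gamma0 N) 2), IsNewform0 f → IsNewform0 g → eigenIdeal f ≠ eigenIdeal g →
        ∀ ℓ : ℕ, ℓ.Prime → heckeCongruenceModulus f (eigenIdeal g) ≠ 0 →
          ℓ ∣ heckeCongruenceModulus f (eigenIdeal g) →
          (ℓ : ℝ) ≤ C * (N : ℝ) ^ (κ * (Module.finrank ℤ (anemicHeckeRing N 2 ⧸ eigenIdeal f) : ℝ))) :
    ∃ κ C : ℝ, ∀ (N : ℕ) [NeZero N], Squarefree N →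
      ∀ (f g : CuspForm (Gamma0 N) 2), IsNewform0 f → IsNewform0 g → eigenIdeal f ≠ eigenIdeal g →
        ∀ ℓ : ℕ, ℓ.Prime → heckeCongruenceModulus f (eigenIdeal g) ≠ 0 →
          ℓ ∣ heckeCongruenceModulus f (eigenIdeal g) →
          (ℓ : ℝ) ≤ C * (N : ℝ) ^ (κ * (min (Module.finrank ℤ (anemicHeckeRing N 2 ⧸ eigenIdeal f))
            (Module.finrank ℤ (anemicHeckeRing N 2 ⧸ eigenIdeal g)) : ℝ)) := by
  obtain ⟨κ, C, h⟩ := hG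
  refine ⟨κ, C, fun N _ hN f g hf hg hne ℓ hℓ h0 hdvd ↦ ?_⟩
  rcases le_total ((Module.finrank ℤ (anemicHeckeRing N 2 ⧸ eigenIdeal f) : ℕ) : ℝ)
      ((Module.finrank ℤ (anemicHeckeRing N 2 ⧸ eigenIdeal g) : ℕ) : ℝ) with hle | hle
  · rw [min_eq_left hle]
    exact h N hN f g hf hg hne ℓ hℓ h0 hdvd
  · rw [min_eq_right hle]
    rw [heckeCongruenceModulus_comm] at h0 hdvd
    exact h N hN g f hg hf hne.symm ℓ hℓ h0 hdvd

/-- **A rational newform has a rank-one orbit**: `rank_ℤ(𝕋/𝕀_f) = 1` for `f ≠ 0` with integral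
eigenvalues (`𝕋/𝕀_f ≃+* ℤ`, `quotEigenIdealEquivInt`). -/
theorem finrank_quotient_eigenIdeal_eq_one {N : ℕ} [NeZero N] {f : CuspForm (Gamma0 N) 2}
    (hf : HasIntegralEigenvalues f) (hf0 : f ≠ 0) :
    Module.finrank ℤ (anemicHeckeRing N 2 ⧸ eigenIdeal f) = 1 := by
  have e : (anemicHeckeRing N 2 ⧸ eigenIdeal f) ≃ₗ[ℤ] ℤ :=
    (quotEigenIdealEquivInt hf hf0).toAddEquiv.toIntLinearEquiv
  rw [e.finrank_eq, Module.finrank_self]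

/-- **Graded ⟹ rational slice**: for a rational newform the graded exponent `κ · rank(𝕋/𝕀_f)` is `κ`. -/
theorem rationalNewPartFriability_of_graded
    (hG : ∃ κ C : ℝ, ∀ (N : ℕ) [NeZero N], Squarefree N →
      ∀ (f g : CuspForm (Gamma0 N) 2), IsNewform0 f → IsNewform0 g → eigenIdeal f ≠ eigenIdeal g →
        ∀ ℓ : ℕ, ℓ.Prime → heckeCongruenceModulus f (eigenIdeal g) ≠ 0 →
          ℓ ∣ heckeCongruenceModulus f (eigenIdeal g) →
          (ℓ : ℝ) ≤ C * (N : ℝ) ^ (κ * (Module.finrank ℤ (anemicHeckeRing N 2 ⧸ eigenIdeal f) : ℝ))) :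
    ∃ κ C : ℝ, ∀ (N : ℕ) [NeZero N], Squarefree N →
      ∀ (f g : CuspForm (Gamma0 N) 2), IsNewform0 f → IsNewform0 g → HasIntegralEigenvalues f →
        eigenIdeal f ≠ eigenIdeal g →
        ∀ ℓ : ℕ, ℓ.Prime → heckeCongruenceModulus f (eigenIdeal g) ≠ 0 →
          ℓ ∣ heckeCongruenceModulus f (eigenIdeal g) → (ℓ : ℝ) ≤ C * (N : ℝ) ^ κ := by
  obtain ⟨κ, C, h⟩ := hG
  refine ⟨κ, C, fun N _ hN f g hf hg hint hne ℓ hℓ h0 hdvd ↦ ?_⟩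
  have := h N hN f g hf hg hne ℓ hℓ h0 hdvd
  rwa [finrank_quotient_eigenIdeal_eq_one hint (newform_ne_zero hf), Nat.cast_one, mul_one] at this

/-- **Rational slice ⟹ datum form**: the newform of a datum of a semistable `W` of conductor `N` is a
rational newform of squarefree level `N` (`factorization_conductorNorm_le_one`), and `η ≠ 0`
against any other newform orbit (`heckeCongruenceModulus_newform_ne_zero`). -/
theorem newPartPrimesOfDatum_of_rationalNewPartFriability
    (hR : ∃ κ C : ℝ, ∀ (N : ℕ) [NeZero N], Squarefree N →
      ∀ (f g : CuspForm (Gamma0 N) 2), IsNewform0 f → IsNewform0 g → HasIntegralEigenvalues f →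
        eigenIdeal f ≠ eigenIdeal g →
        ∀ ℓ : ℕ, ℓ.Prime → heckeCongruenceModulus f (eigenIdeal g) ≠ 0 →
          ℓ ∣ heckeCongruenceModulus f (eigenIdeal g) → (ℓ : ℝ) ≤ C * (N : ℝ) ^ κ) :
    ∃ κ C : ℝ, ∀ (N : ℕ) [NeZero N] (W : WeierstrassCurve ℚ) [W.IsElliptic] [W.IsGloballyMinimal],
      W.IsSemistable ℤ → W.conductorNorm ℤ = N →
      ∀ (D : ModularParametrizationData W N) (g : CuspForm (Gamma0 N) 2), IsNewform0 g →
        eigenIdeal g ≠ eigenIdeal D.f →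
        ∀ ℓ : ℕ, ℓ.Prime → ℓ ∣ heckeCongruenceModulus D.f (eigenIdeal g) →
          (ℓ : ℝ) ≤ C * (N : ℝ) ^ κ := by
  obtain ⟨κ, C, h⟩ := hR
  refine ⟨κ, C, fun N _ W _ _ hW hWN D g hg hne ℓ hℓ hdvd ↦ ?_⟩
  have hsq : Squarefree N := by
    haveI : NeZero (W.conductorNorm ℤ) := ⟨by rw [hWN]; exact NeZero.ne N⟩
    rw [← hWN, Nat.squarefree_iff_factorization_le_one (NeZero.ne _)]
    exact fun p ↦ factorization_conductorNorm_le_one W hW p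
  exact h N hsq D.f g D.isNewformOf.1 hg D.hasIntegralEigenvalues_f hne.symm ℓ hℓ
    (heckeCongruenceModulus_newform_ne_zero D hg hne) hdvd

/-! ## Calibration: the known regime (partner's rank in the exponent) -/

/-- **What is already a theorem**: a congruence prime between the newform of a curve datum at level
`N ≥ 11` and another newform orbit `[g]` is `≤ N^{3 · rank_ℤ(𝕋/𝕀_g)}` — the PARTNER's rank in the
exponent (`log_heckeCongruenceModulus_le_finrank_mul_three_mul_log`, Pasten 2024 proof of Thm 7.2 with
the trivial Hecke bound).  The bet replaces `rank 𝕋/𝕀_g` by `rank 𝕋/𝕀_f = 1`. -/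
theorem newPartPrime_le_rpow_finrank_partner {N : ℕ} [NeZero N] (hN : 11 ≤ N)
    {W : WeierstrassCurve ℚ} [W.IsElliptic] (D : ModularParametrizationData W N)
    {g : CuspForm (Gamma0 N) 2} (hg : IsNewform0 g) (hne : eigenIdeal g ≠ eigenIdeal D.f)
    {ℓ : ℕ} (hdvd : ℓ ∣ heckeCongruenceModulus D.f (eigenIdeal g)) :
    (ℓ : ℝ) ≤ (N : ℝ) ^ (3 * (Module.finrank ℤ (anemicHeckeRing N 2 ⧸ eigenIdeal g) : ℝ)) := by
  have hPmin := newform_eigenIdeal_mem_minimalPrimes hg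
  have h0 := heckeCongruenceModulus_newform_ne_zero D hg hne
  have hlog := Summit.ABC.ABC.Theorems.log_heckeCongruenceModulus_le_finrank_mul_three_mul_log
    N W D hN (eigenIdeal g) hPmin hne
  have hηpos : (0 : ℝ) < heckeCongruenceModulus D.f (eigenIdeal g) := by
    exact_mod_cast Nat.pos_of_ne_zero h0
  have hℓη : (ℓ : ℝ) ≤ heckeCongruenceModulus D.f (eigenIdeal g) := by
    exact_mod_cast Nat.le_of_dvd (Nat.pos_of_ne_zero h0) hdvd
  have hN0 : (0 : ℝ) < N := by exact_mod_cast (show 0 < N by omega)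
  calc (ℓ : ℝ) ≤ heckeCongruenceModulus D.f (eigenIdeal g) := hℓη
    _ = Real.exp (Real.log (heckeCongruenceModulus D.f (eigenIdeal g))) := (Real.exp_log hηpos).symm
    _ ≤ Real.exp ((Module.finrank ℤ (anemicHeckeRing N 2 ⧸ eigenIdeal g) : ℝ) * (3 * Real.log N)) :=
        Real.exp_le_exp.mpr hlog
    _ = (N : ℝ) ^ (3 * (Module.finrank ℤ (anemicHeckeRing N 2 ⧸ eigenIdeal g) : ℝ)) := by
        rw [Real.rpow_def_of_pos hN0]
        congr 1
        ring

/-! ## The valuation bound `v_p(Δ_min) ≤ C · N²` from modularity and Mazur–Kenku alone -/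

/-- **`v_p(Δ_min(W)) ≤ C · N_W²`** for every globally minimal semistable elliptic `W/ℚ`, from
`nonempty_modularParametrizationData`, `PastenShimura2024_minimalDegree_le_163_mul` and the THEOREM
`PastenShimura2024_thm_5_5_holds`: `h(E) ≤ ½ N log N + 9` for `N ≥ N₂`
(`exists_neronLatticeHeight_le_half_mul_log`), Shafarevich below `N₂`
(`exists_faltingsHeight_le_of_conductorNorm_lt`), `log|Δ_min| ≤ 12 h + 16` (Pasten Lemma 18.1,
`exists_log_minimalDiscriminantNorm_le_sq_of_faltingsHeight_le`) and `v_p(n) ≤ log n / log 2`. -/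
theorem discValuation_of_modularity_of_mazurKenku (hmod : nonempty_modularParametrizationData)
    (hMK : PastenShimura2024_minimalDegree_le_163_mul) :
    ∃ κ C : ℝ, ∀ (W : WeierstrassCurve ℚ) [W.IsElliptic] [W.IsGloballyMinimal]
      [NeZero (W.conductorNorm ℤ)], W.IsSemistable ℤ → ∀ p : ℕ,
        (((W.minimalDiscriminantNorm ℤ).factorization p : ℕ) : ℝ) ≤
          C * (W.conductorNorm ℤ : ℝ) ^ κ := by
  obtain ⟨N₂, hN₂⟩ := Summit.ABC.ABC.Theorems.exists_neronLatticeHeight_le_half_mul_log hmod hMK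
    PastenShimura2024_thm_5_5_holds
  obtain ⟨B, hB⟩ := exists_faltingsHeight_le_of_conductorNorm_lt N₂
  have hc : ∀ (W : WeierstrassCurve ℚ) [W.IsElliptic] [W.IsGloballyMinimal]
      [NeZero (W.conductorNorm ℤ)], W.IsSemistable ℤ →
        W.faltingsHeight ≤ max B 10 * (W.conductorNorm ℤ : ℝ) ^ 2 := by
    intro W _ _ _ _
    have hN1 : (1 : ℝ) ≤ (W.conductorNorm ℤ : ℝ) := by
      exact_mod_cast Nat.one_le_iff_ne_zero.2 (NeZero.ne _)
    have hc0 : (0 : ℝ) ≤ max B 10 := le_trans (by norm_num) (le_max_right _ _)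
    have hsq : (1 : ℝ) ≤ (W.conductorNorm ℤ : ℝ) ^ 2 := by nlinarith
    by_cases hN : N₂ ≤ W.conductorNorm ℤ
    · obtain ⟨L, hL⟩ := exists_isNeronLatticeOf_holds (W.baseChange ℂ)
      have hle := hN₂ W L hL hN
      have hlog : Real.log (W.conductorNorm ℤ : ℝ) ≤ (W.conductorNorm ℤ : ℝ) :=
        (Real.log_le_sub_one_of_pos (by linarith)).trans (by linarith)
      have hNN : (W.conductorNorm ℤ : ℝ) * Real.log (W.conductorNorm ℤ) ≤
          (W.conductorNorm ℤ : ℝ) ^ 2 := by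
        rw [sq]
        exact mul_le_mul_of_nonneg_left hlog (by linarith)
      calc W.faltingsHeight
            = neronLatticeHeight L := Summit.ABC.ABC.Theorems.faltingsHeight_eq_neronLatticeHeight W hL
        _ ≤ (W.conductorNorm ℤ : ℝ) * Real.log (W.conductorNorm ℤ) / 2 + 9 := hle
        _ ≤ (W.conductorNorm ℤ : ℝ) ^ 2 / 2 + 9 * (W.conductorNorm ℤ : ℝ) ^ 2 := by
            have h9 : (9 : ℝ) ≤ 9 * (W.conductorNorm ℤ : ℝ) ^ 2 := by nlinarith
            linarith
        _ ≤ 10 * (W.conductorNorm ℤ : ℝ) ^ 2 := by nlinarith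
        _ ≤ max B 10 * (W.conductorNorm ℤ : ℝ) ^ 2 :=
            mul_le_mul_of_nonneg_right (le_max_right _ _) (by positivity)
    · have hlt : W.conductorNorm ℤ < N₂ := lt_of_not_ge hN
      calc W.faltingsHeight ≤ B := hB W hlt
        _ ≤ max B 10 := le_max_left _ _
        _ = max B 10 * 1 := (mul_one _).symm
        _ ≤ max B 10 * (W.conductorNorm ℤ : ℝ) ^ 2 := mul_le_mul_of_nonneg_left hsq hc0
  have hlog := exists_log_minimalDiscriminantNorm_le_sq_of_faltingsHeight_le hc
  exact ⟨2, max (12 * max B 10 + 16) 0 / Real.log 2, fun W _ _ _ hss p ↦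
    factorization_le_of_log_le NeZero.one_le (hlog W hss) p⟩

/-! ## The glue: the datum form of the bet and the known inputs give crux A -/

/-- **Glue** (lead -0's `stub_glue` argument with the datum-form new-part bound `h7` as hypothesis
in place of Hecke separators): (1) a datum for semistable minimal `W`; (MK) Mazur–Kenku; (2) Pasten
Thm 5.5 `δ ∣ ∏_{P ≠ 𝕀_f} η_f(P)`; (4) classification of minimal primes of `𝕋_N`; (5) old-partner
peeling; (6) `v_p(Δ_min) ≤ C N^κ`; (7) new-part bound ⟹ crux A.  Given `W`, take any datum `D₁`, a
class-minimal datum `D₀` with the same newform (well-ordering) and the datum `D` of `W` of degree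
`k · deg D₀`, `k ≤ 163`; a prime `ℓ ∣ deg D` divides `k` or one `η_f(P)`, `P ≠ 𝕀_f` minimal; `P`
new ⇒ (7), `P` old ⇒ `ℓ ≤ v_p(Δ_min) ≤ C N^κ` or `ℓ ∣ N` or `ℓ < 11`.
Constants `κ = max(κ₆, κ₇, 1)`, `C = max C₆ 0 + max C₇ 0 + 163`. -/
theorem degreePrimesPolyBounded_of_newPartPrimesOfDatum
    (h1 : ∀ (W : WeierstrassCurve ℚ) [W.IsElliptic] [W.IsGloballyMinimal]
      [NeZero (W.conductorNorm ℤ)],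
      W.IsSemistable ℤ → Nonempty (ModularParametrizationData W (W.conductorNorm ℤ)))
    (hMK : PastenShimura2024_minimalDegree_le_163_mul)
    (h2 : PastenShimura2024_thm_5_5)
    (h4 : ∀ (N : ℕ) [NeZero N] (P : Ideal (anemicHeckeRing N 2)),
      P ∈ minimalPrimes (anemicHeckeRing N 2) →
      (∃ g : CuspForm (Gamma0 N) 2, IsNewform0 g ∧ P = eigenIdeal g) ∨
      (∃ (M : ℕ) (_ : NeZero M) (hM : M ∣ N), M ≠ N ∧ ∃ g : CuspForm (Gamma0 M) 2,
        IsNewform0 g ∧ P = eigenIdeal (toLevel0 hM 2 g)))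
    (h5 : ∀ (N : ℕ) [NeZero N] (W : WeierstrassCurve ℚ) [W.IsElliptic] [W.IsGloballyMinimal],
      W.IsSemistable ℤ → W.conductorNorm ℤ = N →
      ∀ (D : ModularParametrizationData W N) (M : ℕ) [NeZero M] (hM : M ∣ N), M ≠ N →
      ∀ g : CuspForm (Gamma0 M) 2, IsNewform0 g →
      ∀ ℓ : ℕ, ℓ.Prime →
        heckeCongruenceModulus D.f (eigenIdeal (toLevel0 hM 2 g)) ≠ 0 →
        ℓ ∣ heckeCongruenceModulus D.f (eigenIdeal (toLevel0 hM 2 g)) →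
        (∃ p : ℕ, p.Prime ∧ p ∣ N ∧ 0 < (W.minimalDiscriminantNorm ℤ).factorization p ∧
            ℓ ∣ (W.minimalDiscriminantNorm ℤ).factorization p) ∨ ℓ ∣ N ∨ ℓ < 11)
    (h6 : ∃ κ C : ℝ, ∀ (W : WeierstrassCurve ℚ) [W.IsElliptic] [W.IsGloballyMinimal]
      [NeZero (W.conductorNorm ℤ)], W.IsSemistable ℤ → ∀ p : ℕ,
        (((W.minimalDiscriminantNorm ℤ).factorization p : ℕ) : ℝ) ≤
          C * (W.conductorNorm ℤ : ℝ) ^ κ)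
    (h7 : ∃ κ C : ℝ, ∀ (N : ℕ) [NeZero N] (W : WeierstrassCurve ℚ) [W.IsElliptic]
      [W.IsGloballyMinimal], W.IsSemistable ℤ → W.conductorNorm ℤ = N →
      ∀ (D : ModularParametrizationData W N) (g : CuspForm (Gamma0 N) 2), IsNewform0 g →
        eigenIdeal g ≠ eigenIdeal D.f →
        ∀ ℓ : ℕ, ℓ.Prime → ℓ ∣ heckeCongruenceModulus D.f (eigenIdeal g) →
          (ℓ : ℝ) ≤ C * (N : ℝ) ^ κ) :
    DegreePrimesPolyBounded := by
  classical
  obtain ⟨κ₆, C₆, h6⟩ := h6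
  obtain ⟨κ₇, C₇, h7⟩ := h7
  refine ⟨max (max κ₆ κ₇) 1, max C₆ 0 + max C₇ 0 + 163, ?_⟩
  intro W _ _ _ hW
  set κ : ℝ := max (max κ₆ κ₇) 1 with hκdef
  set C : ℝ := max C₆ 0 + max C₇ 0 + 163 with hCdef
  have hκ6 : κ₆ ≤ κ := (le_max_left _ _).trans (le_max_left _ _)
  have hκ7 : κ₇ ≤ κ := (le_max_right _ _).trans (le_max_left _ _)
  have hκ1 : 1 ≤ κ := le_max_right _ _
  have hC6 : C₆ ≤ C := by
    have : (0 : ℝ) ≤ max C₇ 0 := le_max_right _ _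
    linarith [le_max_left C₆ 0]
  have hC7 : C₇ ≤ C := by
    have : (0 : ℝ) ≤ max C₆ 0 := le_max_right _ _
    linarith [le_max_left C₇ 0]
  have hC163 : (163 : ℝ) ≤ C := by
    have h1' : (0 : ℝ) ≤ max C₆ 0 := le_max_right _ _
    have h2' : (0 : ℝ) ≤ max C₇ 0 := le_max_right _ _
    linarith
  have hC1 : (1 : ℝ) ≤ C := by linarith
  have hC0 : (0 : ℝ) ≤ C := by linarith
  set N : ℕ := W.conductorNorm ℤ with hNdef
  have hN1 : (1 : ℝ) ≤ (N : ℝ) := by exact_mod_cast NeZero.one_le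
  -- a datum of `W`; a class-minimal datum with the same newform; the datum of `W` of degree `k · deg D₀`
  obtain ⟨D₁⟩ := h1 W hW
  let S : Set ℕ := {n | ∃ (W' : WeierstrassCurve ℚ) (_ : W'.IsElliptic)
    (D' : ModularParametrizationData W' N), D'.f = D₁.f ∧ D'.modularDegree = n}
  have hS : ∃ n, n ∈ S := ⟨D₁.modularDegree, W, inferInstance, D₁, rfl, rfl⟩
  obtain ⟨W₀, hW₀ell, D₀, hf₀, hdeg₀⟩ := Nat.find_spec hS
  have hmin : ∀ (W' : WeierstrassCurve ℚ) [W'.IsElliptic] (D' : ModularParametrizationData W' N),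
      D'.f = D₀.f → D₀.modularDegree ≤ D'.modularDegree := by
    intro W' _ D' hf'
    rw [hdeg₀]
    exact Nat.find_min' hS ⟨W', inferInstance, D', hf'.trans hf₀, rfl⟩
  obtain ⟨D, k, hfD, hk0, hk163, hdegD⟩ :=
    PastenShimura2024_exists_datum_modularDegree_eq_mul_of hMK N W₀ W D₀ D₁ hf₀.symm hmin
  refine ⟨D, fun ℓ hℓ hdvd ↦ ?_⟩
  change ℓ ∣ D.modularDegree at hdvd
  rw [hdegD] at hdvd
  rcases (Nat.Prime.dvd_mul hℓ).mp hdvd with hk | hδ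
  · -- `ℓ ∣ k ≤ 163`
    have : (ℓ : ℝ) ≤ 163 := by exact_mod_cast (Nat.le_of_dvd hk0 hk).trans hk163
    exact le_mul_rpow_of_le (this.trans hC163) hC0 (zero_le_one.trans hκ1) hN1
  · -- `ℓ ∣ deg D₀ ∣ ∏ η(P)`
    have hprod := h2 N W₀ D₀ hmin
    have hℓprod := hδ.trans hprod
    obtain ⟨P, hPmem, hℓP⟩ := (Nat.prime_iff.mp hℓ).exists_mem_finset_dvd hℓprod
    have hPne : P ≠ eigenIdeal D₀.f := Finset.ne_of_mem_erase hPmem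
    have hPmin : P ∈ minimalPrimes (anemicHeckeRing N 2) :=
      (finite_minimalPrimes_anemicHeckeRing N 2).mem_toFinset.mp (Finset.mem_of_mem_erase hPmem)
    have hff : D₀.f = D.f := hfD.symm
    rw [hff] at hPne hℓP
    have hη0 : heckeCongruenceModulus D.f P ≠ 0 := D.heckeCongruenceModulus_ne_zero hPmin hPne
    rcases h4 N P hPmin with ⟨g, hg, rfl⟩ | ⟨M, hM0, hM, hMN, g, hg, rfl⟩
    · -- new partner: the bet (datum form)
      have := h7 N W hW rfl D g hg hPne ℓ hℓ hℓP
      exact le_of_le_mul_rpow this hC7 hκ7 hC0 hN1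
    · -- old partner: Tamagawa exponent, or `ℓ ∣ N`, or `ℓ < 11`
      rcases h5 N W hW rfl D M hM hMN g hg ℓ hℓ hη0 hℓP with
        ⟨p, hp, hpN, hvpos, hℓv⟩ | hℓN | hℓ11
      · have h1' : (ℓ : ℝ) ≤ ((W.minimalDiscriminantNorm ℤ).factorization p : ℕ) := by
          exact_mod_cast Nat.le_of_dvd hvpos hℓv
        exact le_of_le_mul_rpow (h1'.trans (h6 W hW p)) hC6 hκ6 hC0 hN1
      · have h1' : (ℓ : ℝ) ≤ (N : ℝ) := by exact_mod_cast Nat.le_of_dvd NeZero.one_le hℓN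
        exact h1'.trans (self_le_mul_rpow hC1 hκ1 hN1)
      · have h1' : (ℓ : ℝ) ≤ 163 := by exact_mod_cast (by omega : ℓ ≤ 163)
        exact le_mul_rpow_of_le (h1'.trans hC163) hC0 (zero_le_one.trans hκ1) hN1

/-! ## Composition in hypothesis form (registered stub `stub_frame`) -/

/-- STUB (PROVED) — **the frame of line `newpart-congruence-friability`: the four stub statements
imply crux A**: `ModularDatumExists → PastenShimura2024_minimalDegree_le_163_mul → (old-level Galois
input) → (graded new-part friability) → DegreePrimesPolyBounded`, through the PROVED `stub_spectral`
(Pasten Thm 5.5), `stub_minimalPrimes` (Atkin–Lehner–Li), `stub_oldPartner_of` (peeling),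
`discValuation_of_modularity_of_mazurKenku`, the reductions graded ⟹ rational ⟹ datum form, and
the glue `degreePrimesPolyBounded_of_newPartPrimesOfDatum`. -/
theorem stub_frame :
    ModularDatumExists →
    PastenShimura2024_minimalDegree_le_163_mul →
    (∀ (N : ℕ) [NeZero N] (W : WeierstrassCurve ℚ) [W.IsElliptic] [W.IsGloballyMinimal],
      W.IsSemistable ℤ → W.conductorNorm ℤ = N →
      ∀ (f : CuspForm (Gamma0 N) 2), IsNewformOf W f →
      ∀ (M : ℕ) [NeZero M] (hM : M ∣ N) (g : CuspForm (Gamma0 M) 2), IsNewform0 g →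
      ∀ (p ℓ : ℕ), p.Prime → ℓ.Prime → p ∣ N → ¬ p ∣ M → ¬ ℓ ∣ N → 11 ≤ ℓ →
      ∀ 𝔪 : Ideal (anemicHeckeRing N 2), 𝔪.IsMaximal → (ℓ : anemicHeckeRing N 2) ∈ 𝔪 →
        eigenIdeal f ≤ 𝔪 → eigenIdeal (toLevel0 hM 2 g) ≤ 𝔪 →
        ℓ ∣ (W.minimalDiscriminantNorm ℤ).factorization p) →
    (∃ κ C : ℝ, ∀ (N : ℕ) [NeZero N], Squarefree N →
      ∀ (f g : CuspForm (Gamma0 N) 2), IsNewform0 f → IsNewform0 g →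
        eigenIdeal f ≠ eigenIdeal g →
        ∀ ℓ : ℕ, ℓ.Prime → heckeCongruenceModulus f (eigenIdeal g) ≠ 0 →
          ℓ ∣ heckeCongruenceModulus f (eigenIdeal g) →
          (ℓ : ℝ) ≤ C * (N : ℝ) ^
            (κ * (Module.finrank ℤ (anemicHeckeRing N 2 ⧸ eigenIdeal f) : ℝ))) →
    Summit.ABC.ABC.Theses.IsogenyGlueCongruence.DegreePrimesPolyBounded := by
  intro hmod hMK hGal hG
  exact degreePrimesPolyBounded_of_newPartPrimesOfDatum (fun W _ _ _ _ ↦ hmod W) hMK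
    stub_spectral stub_minimalPrimes (stub_oldPartner_of hGal)
    (discValuation_of_modularity_of_mazurKenku hmod hMK)
    (newPartPrimesOfDatum_of_rationalNewPartFriability (rationalNewPartFriability_of_graded hG))

/-- **Crux A from the three known statements and the RANK-ONE slice of the bet** (what the line
actually consumes: congruence primes between a rational newform of squarefree level `N` and any other
newform orbit of level `N` are `≤ C · N^κ`). -/
theorem degreePrimesPolyBounded_of_rationalNewPartFriability (hmod : ModularDatumExists)
    (hMK : PastenShimura2024_minimalDegree_le_163_mul)
    (hGal : ∀ (N : ℕ) [NeZero N] (W : WeierstrassCurve ℚ) [W.IsElliptic] [W.IsGloballyMinimal],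
      W.IsSemistable ℤ → W.conductorNorm ℤ = N →
      ∀ (f : CuspForm (Gamma0 N) 2), IsNewformOf W f →
      ∀ (M : ℕ) [NeZero M] (hM : M ∣ N) (g : CuspForm (Gamma0 M) 2), IsNewform0 g →
      ∀ (p ℓ : ℕ), p.Prime → ℓ.Prime → p ∣ N → ¬ p ∣ M → ¬ ℓ ∣ N → 11 ≤ ℓ →
      ∀ 𝔪 : Ideal (anemicHeckeRing N 2), 𝔪.IsMaximal → (ℓ : anemicHeckeRing N 2) ∈ 𝔪 →
        eigenIdeal f ≤ 𝔪 → eigenIdeal (toLevel0 hM 2 g) ≤ 𝔪 →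
        ℓ ∣ (W.minimalDiscriminantNorm ℤ).factorization p)
    (hR : ∃ κ C : ℝ, ∀ (N : ℕ) [NeZero N], Squarefree N →
      ∀ (f g : CuspForm (Gamma0 N) 2), IsNewform0 f → IsNewform0 g → HasIntegralEigenvalues f →
        eigenIdeal f ≠ eigenIdeal g →
        ∀ ℓ : ℕ, ℓ.Prime → heckeCongruenceModulus f (eigenIdeal g) ≠ 0 →
          ℓ ∣ heckeCongruenceModulus f (eigenIdeal g) → (ℓ : ℝ) ≤ C * (N : ℝ) ^ κ) :
    DegreePrimesPolyBounded :=
  degreePrimesPolyBounded_of_newPartPrimesOfDatum (fun W _ _ _ _ ↦ hmod W) hMK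
    stub_spectral stub_minimalPrimes (stub_oldPartner_of hGal)
    (discValuation_of_modularity_of_mazurKenku hmod hMK)
    (newPartPrimesOfDatum_of_rationalNewPartFriability hR)

end Summit.ABC.ABC.Theorems.DegreePrimesPolyBounded

end
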